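import Summits.AnomalousDissipation.AnomalousDissipation.Theorems.UniformResolution.Negative.RowBarrier

/-!
# Negative knowledge for the crux `UniformResolution` (stmt-AnomalousDissipation-14330), XI:
# MIXING NEVER CREATES RESOLUTION (freedom F1 of the conclusion is void) — and admixture cannot repair the leak family

Generic part: the mixing lemma of the strategist seat planner-cstrat-stmt-AnomalousDissipation-14330-b1-0
(`Cruxes/UniformResolution/StrategistSketchB1.lean`, §Decomposition F1, kernel-checked there but never landed), restated with an
EXPLICIT, law-independent reparametrisation index and landed here by the standing disprover (generation 2,
refuter-cdisprove-stmt-AnomalousDissipation-14330-g2-0). Supports stmt-AnomalousDissipation-14330; no route-item statement is asserted.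

* `lintegral_band_le` — band enstrophy `≤` total enstrophy in the mean.
* `resolved_left_at_of_isResolved_mixture` — if `a • μ₁ + b • μ₂` is `κ`-resolved (`a ≠ 0` finite, `b·∫‖∇u‖²dμ₂ < ∞`), then for
  every tolerance `(n+1)⁻¹` and every index `m` with `m⁻¹ < a (n+1)⁻¹` (a condition on `a, n, m` ONLY) the cutoff `κ m` resolves `μ₁`
  alone to tolerance `(n+1)⁻¹`; `exists_isResolved_left_of_mixture` — hence `μ₁` is resolved by the law-INDEPENDENT reparametrised
  schedule `n ↦ κ (mixIdx a n)`. So the conclusion's freedom "replace the loud law by a convex combination with resolved laws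
  (steady Diracs, laminar states)" cannot create resolution: a mixture leaks iff a component of fixed positive weight leaks.
* `not_isResolved_mixture_leakLaw` — COMBINED WITH THE ROW BARRIER (`Negative/RowBarrier.lean`): no schedule resolves the mixtures
  `a • leakLaw m + b • μ₂ m` (any admixed laws `μ₂ m` with `b·∫‖∇u‖²dμ₂ m < ∞`, fixed weight `a ≠ 0`), at all levels simultaneously.
-/

namespace Summit.AnomalousDissipation.AnomalousDissipation.Theorems.UniformResolution.Negative

open MeasureTheory Filter Topology
open scoped ENNReal
open Literature.Analysis.FunctionSpaces Literature.Analysis.FluidPDE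

noncomputable section

/-- Local notation for the real Hilbert space `L²(T³; ℝ³)`. -/
local notation "L2T3" => Lp (EuclideanSpace ℝ (Fin 3)) 2 (volume : Measure (UnitAddTorus (Fin 3)))

section Mixture

/-- Band enstrophy is at most total enstrophy, in the mean (spectral, termwise). [folklore] -/
theorem lintegral_band_le (K : ℕ) (μ : Measure (Torus.energySpace (Fin 3))) :
    ∫⁻ u, Torus.eGradNormSq (Torus.fourierTruncate K ((u.1 : L2T3) : UnitAddTorus (Fin 3) → EuclideanSpace ℝ (Fin 3))) ∂μ ≤
      ∫⁻ u, Torus.eGradNormSq ((u.1 : L2T3) : UnitAddTorus (Fin 3) → EuclideanSpace ℝ (Fin 3)) ∂μ :=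
  lintegral_mono fun u => Torus.eGradNormSq_fourierTruncate_le ((Lp.memLp (u.1 : L2T3)).integrable one_le_two) K

/-- **MIXING LEMMA, explicit index.** If the mixture `a • μ₁ + b • μ₂` (`a ≠ 0` finite, `b · ∫‖∇u‖²dμ₂ < ∞`) is `κ`-resolved, then at
every index `m` with `m⁻¹ < a (n+1)⁻¹` — a condition on `a, n, m` only, NOT on the laws — the cutoff `κ m` resolves `μ₁` alone to
tolerance `(n+1)⁻¹`. (Strategist b1's `resolvable_left_of_isResolved_mixture`, with the index made explicit.) [folklore] -/
theorem resolved_left_at_of_isResolved_mixture {κ : ℕ → ℕ} {μ₁ μ₂ : Measure (Torus.energySpace (Fin 3))} {a b : ℝ≥0∞}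
    (ha : a ≠ 0) (ha' : a ≠ ⊤)
    (hfin : b * ∫⁻ u, Torus.eGradNormSq ((u.1 : L2T3) : UnitAddTorus (Fin 3) → EuclideanSpace ℝ (Fin 3)) ∂μ₂ ≠ ⊤)
    (hres : IsResolved κ (a • μ₁ + b • μ₂)) {n m : ℕ} (hm : ((m : ℝ≥0∞))⁻¹ < a * (((n : ℝ≥0∞)) + 1)⁻¹) :
    ∫⁻ u, Torus.eGradNormSq ((u.1 : L2T3) : UnitAddTorus (Fin 3) → EuclideanSpace ℝ (Fin 3)) ∂μ₁ ≤
      (∫⁻ u, Torus.eGradNormSq (Torus.fourierTruncate (κ m)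
          ((u.1 : L2T3) : UnitAddTorus (Fin 3) → EuclideanSpace ℝ (Fin 3))) ∂μ₁) + ((n : ℝ≥0∞) + 1)⁻¹ := by
  set c : ℝ≥0∞ := a * ((n : ℝ≥0∞) + 1)⁻¹ with hc
  set Z₁ : ℝ≥0∞ := ∫⁻ u, Torus.eGradNormSq ((u.1 : L2T3) : UnitAddTorus (Fin 3) → EuclideanSpace ℝ (Fin 3)) ∂μ₁ with hZ₁
  set Z₂ : ℝ≥0∞ := ∫⁻ u, Torus.eGradNormSq ((u.1 : L2T3) : UnitAddTorus (Fin 3) → EuclideanSpace ℝ (Fin 3)) ∂μ₂ with hZ₂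
  set B₁ : ℝ≥0∞ := ∫⁻ u, Torus.eGradNormSq (Torus.fourierTruncate (κ m)
    ((u.1 : L2T3) : UnitAddTorus (Fin 3) → EuclideanSpace ℝ (Fin 3))) ∂μ₁ with hB₁
  set B₂ : ℝ≥0∞ := ∫⁻ u, Torus.eGradNormSq (Torus.fourierTruncate (κ m)
    ((u.1 : L2T3) : UnitAddTorus (Fin 3) → EuclideanSpace ℝ (Fin 3))) ∂μ₂ with hB₂
  set e : ℝ≥0∞ := ((m : ℝ≥0∞) + 1)⁻¹ with he
  -- the resolution inequality of the mixture at index `m`, split over the two components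
  have hmix : a * Z₁ + b * Z₂ ≤ a * B₁ + b * B₂ + e := by
    have h := hres m
    simp only [lintegral_add_measure, lintegral_smul_measure] at h
    simpa [hZ₁, hZ₂, hB₁, hB₂, smul_eq_mul] using h
  -- the second component's band part is at most its total, and finite
  have hB₂le : b * B₂ ≤ b * Z₂ := mul_le_mul_right (lintegral_band_le (κ m) μ₂) b
  have hB₂fin : b * B₂ ≠ ⊤ := ne_top_of_le_ne_top hfin hB₂le
  -- cancel `b * B₂`
  have hstep : a * Z₁ + b * B₂ ≤ (a * B₁ + e) + b * B₂ := by
    calc a * Z₁ + b * B₂ ≤ a * Z₁ + b * Z₂ := add_le_add le_rfl hB₂le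
      _ ≤ a * B₁ + b * B₂ + e := hmix
      _ = (a * B₁ + e) + b * B₂ := by ring
  have haZ : a * Z₁ ≤ a * B₁ + e := ENNReal.le_of_add_le_add_right hB₂fin hstep
  -- divide by `a`
  have hdiv : Z₁ ≤ B₁ + a⁻¹ * e := by
    have h1 : a⁻¹ * (a * Z₁) ≤ a⁻¹ * (a * B₁ + e) := mul_le_mul_right haZ _
    have hinv : a⁻¹ * a = 1 := ENNReal.inv_mul_cancel ha ha'
    calc Z₁ = a⁻¹ * (a * Z₁) := by rw [← mul_assoc, hinv, one_mul]
      _ ≤ a⁻¹ * (a * B₁ + e) := h1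
      _ = B₁ + a⁻¹ * e := by rw [mul_add, ← mul_assoc, hinv, one_mul]
  -- the index makes `a⁻¹ * e ≤ (n+1)⁻¹`
  have hem : e ≤ c := by
    have h1 : e ≤ (m : ℝ≥0∞)⁻¹ := ENNReal.inv_le_inv.2 (by simp)
    exact h1.trans hm.le
  have htol : a⁻¹ * e ≤ ((n : ℝ≥0∞) + 1)⁻¹ := by
    calc a⁻¹ * e ≤ a⁻¹ * c := mul_le_mul_right hem _
      _ = ((n : ℝ≥0∞) + 1)⁻¹ := by rw [hc, ← mul_assoc, ENNReal.inv_mul_cancel ha ha', one_mul]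
  exact hdiv.trans (add_le_add le_rfl htol)

/-- A law-INDEPENDENT admissible index: some `m` with `m⁻¹ < a (n+1)⁻¹` (`a ≠ 0`). [folklore] -/
theorem exists_mixIdx {a : ℝ≥0∞} (ha : a ≠ 0) (n : ℕ) : ∃ m : ℕ, ((m : ℝ≥0∞))⁻¹ < a * (((n : ℝ≥0∞)) + 1)⁻¹ :=
  ENNReal.exists_inv_nat_lt (mul_ne_zero ha (ENNReal.inv_ne_zero.2 (by simp)))

/-- **MIXING NEVER CREATES RESOLUTION (freedom F1 void).** If `a • μ₁ + b • μ₂` is `κ`-resolved (`a ≠ 0` finite, `b·∫‖∇u‖²dμ₂ < ∞`),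
then `μ₁` is resolved by a reparametrisation `κ ∘ m` of the same schedule, where `m : ℕ → ℕ` depends on `a` ONLY (not on the laws).
Strategist b1's `exists_isResolved_left_of_mixture`, uniformised. [folklore] -/
theorem exists_isResolved_left_of_mixture {a : ℝ≥0∞} (ha : a ≠ 0) (ha' : a ≠ ⊤) :
    ∃ m : ℕ → ℕ, ∀ (κ : ℕ → ℕ) (μ₁ μ₂ : Measure (Torus.energySpace (Fin 3))) (b : ℝ≥0∞),
      b * ∫⁻ u, Torus.eGradNormSq ((u.1 : L2T3) : UnitAddTorus (Fin 3) → EuclideanSpace ℝ (Fin 3)) ∂μ₂ ≠ ⊤ →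
      IsResolved κ (a • μ₁ + b • μ₂) → IsResolved (fun n => κ (m n)) μ₁ := by
  choose m hm using exists_mixIdx ha
  exact ⟨m, fun κ μ₁ μ₂ b hfin hres n => resolved_left_at_of_isResolved_mixture ha ha' hfin hres (hm n)⟩

/-- **ADMIXTURE CANNOT REPAIR THE LEAK FAMILY** (row barrier + mixing lemma): for every schedule `κ`, every fixed weight `a ≠ 0`
(finite) and any admixed laws `μ₂ m` with `b · ∫‖∇u‖²dμ₂ m < ∞`, the mixtures `a • leakLaw m + b • μ₂ m` are NOT all `κ`-resolved —
otherwise ONE law-independent reparametrisation of `κ` would resolve every `leakLaw m`, contradicting `not_isResolved_leakLaw`. [folklore] -/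
theorem not_isResolved_mixture_leakLaw (κ : ℕ → ℕ) {a b : ℝ≥0∞} (ha : a ≠ 0) (ha' : a ≠ ⊤)
    (μ₂ : ℕ → Measure (Torus.energySpace (Fin 3)))
    (hfin : ∀ m, b * ∫⁻ u, Torus.eGradNormSq ((u.1 : L2T3) : UnitAddTorus (Fin 3) → EuclideanSpace ℝ (Fin 3)) ∂μ₂ m ≠ ⊤) :
    ¬ ∀ m : ℕ, IsResolved κ (a • leakLaw m + b • μ₂ m) := by
  intro h
  obtain ⟨r, hr⟩ := exists_isResolved_left_of_mixture ha ha'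
  have hall : ∀ m, IsResolved (fun n => κ (r n)) (leakLaw m) := fun m => hr κ (leakLaw m) (μ₂ m) b (hfin m) (h m)
  exact not_isResolved_leakLaw (fun n => κ (r n)) (hall _)

end Mixture

end

end Summit.AnomalousDissipation.AnomalousDissipation.Theorems.UniformResolution.Negative
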